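/-
Copyright (c) 2026 the pub-hodgecm-mathlib formalisation cell (harness21).  Prover seat hodgecm-mathlib-K2E1-p02 (g5), Track B ∕ K2-LIT, crux hLiu418 =
`stmt-HodgeConjecture-24832`, road `K2_Liu`, socket #41 organ O41.5 (Gindikin–Karpelevich), residual (r3) at every rank: the SPHERICAL REDUCTION of the local
Siegel intertwining operator — `M_v φ°_s = (M_v φ°_s)(1) · φ°'`, hypothesis-first on the intertwining property (authorised K2E1-plan (g3) 05:02:05Z).  2026-09-04.
-/
import Literature.NumberTheory.K2Lit.LocalSiegelIntertwining   -- ★ D10 (K2Liu): `localIntertwining`, `IsSphericalSection`, `unipDeltaLocal`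
import HarnessLib

/-!
# hLiu418 ∕ Track B «K2-LIT», #41 organ O41.5 residual (r3) — helper `K2LiuLocalIntertwiningSphericalReduction`:
# `M_v φ (h) = M_v φ (1) · φ'(h)` for `φ` spherical in `I_v(s, χ_v)` and `φ'` THE spherical vector of the target space, once `M_v φ` is a section of it

Cell `pub/hodgecm-mathlib`, crux HLiu418 = `stmt-HodgeConjecture-24832` (helper lane of the K2E1 seat: `--kind proof --supports stmt-HodgeConjecture-24833 --as helper`,
count-neutral; the file pays into #41's O41.5, steward K2Liu-p01 (g4), per the priority call K2E1-plan (g3) 2026-09-04T05:02:05Z (LEAD F0P6-plan (g11) 05:01:57Z),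
memo `K2/K2E1-p02/g5/MEMO-R5b-loc-N2.md` (r3)).  THEOREMS ONLY (no `def`, no `instance`, no `notation`, no named-fact hypothesis, no `sorry`).

THE REDUCTION (Casselman (1980) §3; Harris–Kudla–Sweet (1996) §6 (6.14)).  Let `φ` be spherical in `I_v(s, χ_v)` (★ `IsSphericalSection`: a Siegel section, right
`K_v`-invariant, `φ(1) = 1`) and `M_v φ (h) = ∫_{N_Δ(F_v)} φ(w_Δ u h) dνN(u)` (★ `localIntertwining`, ANY measure `νN`).  Then:
* §1 `localIntertwining_mul_of_mem_localInt` — `M_v φ (h k) = M_v φ (h)` for `k ∈ K_v` (pointwise under the integral; no measure theory);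
  `localIntertwining_apply_of_mem_localInt` — `M_v φ (k) = M_v φ (1)`.
* §2 **`localIntertwining_eq_apply_one_mul`** — IF `M_v φ` is a Siegel section of some `I_v(s', χ'_v)` (the INTERTWINING PROPERTY, hypothesis `hM`; its proof —
  `P_Δ`-equivariance of `u ↦ p u p⁻¹` on `N_Δ(F_v)` with the modulus `|det_Δ|^{n}` and `w_Δ m w_Δ⁻¹ = m^{−*}` — is the remaining organ) and `φ'` is spherical in
  `I_v(s', χ'_v)`, then through the Iwasawa decomposition `H(F_v) = P_Δ(F_v) K_v` (hypothesis `hIw`, ★ `K2LiuLocalSiegelIwasawa.exists_isSiegelDelta_mul_mem_localInt`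
  at good places): `M_v φ (h) = M_v φ (1) · φ'(h)` for EVERY `h` — so `M_v φ°_s = c_v(s) · φ°_{−s}` with `c_v(s) = M_v φ°_s (1)`, the number ★
  `K2LiuGKRankOneValue.integral_apply_weylDelta_nElem_coord` computes at `n = 1` once the Haar measure of `N_Δ(F_v)` is transported to `F_v` (residual (r1)).
  `localIntertwining_eq_smul` — the same as an identity of functions; `localIntertwining_eq_zero_of_apply_one` — if `M_v φ (1) = 0` then `M_v φ = 0`.
No rank-one hypothesis: every `n`.

HONEST LABEL.  Count-neutral helper; proves no printed statement; HC_CM is proved only modulo the 7 printed citations (2 remaining named inputs: hLiu418 =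
`stmt-HodgeConjecture-24832`, h413 = `stmt-HodgeConjecture-24833`) until rung 0 closes.

## References
* [Casselman1980] W. Casselman, *The unramified principal series of p-adic groups I*, Compositio Math. 40 (1980), §3 (intertwining operators on spherical vectors).
* [HarrisKudlaSweet1996] M. Harris, S. Kudla, W. J. Sweet, *Theta dichotomy for unitary groups*, J. AMS 9 (1996), §6 (6.14)–(6.16).
-/

set_option autoImplicit false
set_option linter.dupNamespace false  -- the mandated namespace repeats the summit's segment (`HodgeConjecture.HodgeConjecture`)

noncomputable section

open NumberField IsDedekindDomain MeasureTheory Matrix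
open Literature.NumberTheory.Automorphic Literature.NumberTheory.Automorphic.UnitaryGroup
open Literature.NumberTheory.GelbartRogawski1991.AdaptedBlocks
open Literature.NumberTheory.GelbartRogawski1991.UnitaryDualPair.LocalSplitting
open Literature.NumberTheory.K2Lit.LocalSiegelDoubled

namespace Summit.HodgeConjecture.HodgeConjecture.Cruxes.HLiu418.K2LiuLocalIntertwiningSphericalReduction

variable (F : Type) [Field F] [NumberField F] (E : Type) [Field E] [NumberField E] [Algebra F E]
  [Algebra.IsQuadraticExtension F E] (c : E ≃ₐ[F] E)
  {δ : E} (hcδ : c δ = -δ) (hδ : δ ≠ 0) {d : F} (hd : δ * δ = algebraMap F E d)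
  (v : HeightOneSpectrum (𝓞 F)) (n : ℕ) {T₀ : Matrix (Fin n) (Fin n) F} (hT₀ : T₀.IsSymm)
  {JD : Matrix (Fin (n + n)) (Fin (n + n)) E} (hJD : JD = (gramD F n T₀).map (algebraMap F E))

/-! ## §1 `M_v φ` is right-`K_v`-invariant when `φ` is -/

omit [Algebra.IsQuadraticExtension F E] in
/-- **`M_v φ (h k) = M_v φ (h)` for `k ∈ K_v`** when `φ` is right-`K_v`-invariant (pointwise under the integral sign: `φ(w_Δ u h k) = φ(w_Δ u h)`; any measure).
[cite: Casselman1980, §3] -/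
theorem localIntertwining_mul_of_mem_localInt [MeasurableSpace (unipDeltaLocal F E c v n (JD := JD))]
    (νN : Measure (unipDeltaLocal F E c v n (JD := JD))) {φ : UnitaryGroup.localPi E c (n + n) JD v → ℂ}
    (hφK : ∀ k ∈ UnitaryGroup.localInt E c (n + n) JD v, ∀ h : UnitaryGroup.localPi E c (n + n) JD v, φ (h * k) = φ h)
    {k : UnitaryGroup.localPi E c (n + n) JD v} (hk : k ∈ UnitaryGroup.localInt E c (n + n) JD v) (h : UnitaryGroup.localPi E c (n + n) JD v) :
    localIntertwining F E c v n hJD νN φ (h * k) = localIntertwining F E c v n hJD νN φ h := by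
  unfold localIntertwining
  refine integral_congr_ae (Filter.Eventually.of_forall fun u => ?_)
  show φ (weylDelta F E c v n hJD * (u : UnitaryGroup.localPi E c (n + n) JD v) * (h * k)) =
    φ (weylDelta F E c v n hJD * (u : UnitaryGroup.localPi E c (n + n) JD v) * h)
  rw [← mul_assoc, hφK k hk]

omit [Algebra.IsQuadraticExtension F E] in
/-- `M_v φ (k) = M_v φ (1)` for `k ∈ K_v`, `φ` right-`K_v`-invariant. [cite: Casselman1980, §3] -/
theorem localIntertwining_apply_of_mem_localInt [MeasurableSpace (unipDeltaLocal F E c v n (JD := JD))]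
    (νN : Measure (unipDeltaLocal F E c v n (JD := JD))) {φ : UnitaryGroup.localPi E c (n + n) JD v → ℂ}
    (hφK : ∀ k ∈ UnitaryGroup.localInt E c (n + n) JD v, ∀ h : UnitaryGroup.localPi E c (n + n) JD v, φ (h * k) = φ h)
    {k : UnitaryGroup.localPi E c (n + n) JD v} (hk : k ∈ UnitaryGroup.localInt E c (n + n) JD v) :
    localIntertwining F E c v n hJD νN φ k = localIntertwining F E c v n hJD νN φ 1 := by
  rw [← one_mul k, localIntertwining_mul_of_mem_localInt F E c v n hJD νN hφK hk]

/-! ## §2 The spherical reduction `M_v φ = M_v φ (1) · φ'` -/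

/-- **THE SPHERICAL REDUCTION OF THE LOCAL INTERTWINING OPERATOR.**  Let `H(F_v) = P_Δ(F_v) · K_v` (`hIw`), `φ` right-`K_v`-invariant (e.g. spherical in
`I_v(s, χ_v)`), and suppose `M_v φ = localIntertwining νN φ` is a Siegel section of `I_v(s', χ'_v)` (`hM`, the intertwining property) while `φ'` is THE spherical
section of `I_v(s', χ'_v)`.  Then `M_v φ (h) = M_v φ (1) · φ'(h)` for every `h ∈ H(F_v)`: write `h = p k`; both sides are `χ'-character(p)` times their value on
`K_v`, which is `M_v φ (1)` resp. `1`. [cite: Casselman1980, §3] [cite: HarrisKudlaSweet1996, §6 (6.14)] -/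
theorem localIntertwining_eq_apply_one_mul [MeasurableSpace (unipDeltaLocal F E c v n (JD := JD))]
    (νN : Measure (unipDeltaLocal F E c v n (JD := JD)))
    (hIw : ∀ h : UnitaryGroup.localPi E c (n + n) JD v, ∃ p k : UnitaryGroup.localPi E c (n + n) JD v,
      IsSiegelDelta F E c hcδ hδ hd v n hT₀ hJD p ∧ k ∈ UnitaryGroup.localInt E c (n + n) JD v ∧ h = p * k)
    {φ : UnitaryGroup.localPi E c (n + n) JD v → ℂ}
    (hφK : ∀ k ∈ UnitaryGroup.localInt E c (n + n) JD v, ∀ h : UnitaryGroup.localPi E c (n + n) JD v, φ (h * k) = φ h)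
    (χv' : ∀ w : PlacesOver E v, (w.1.adicCompletion E)ˣ →* ℂˣ) (s' : ℂ)
    (hM : IsLocalSiegelSection F E c hcδ hδ hd v n hT₀ hJD χv' s' (localIntertwining F E c v n hJD νN φ))
    {φ' : UnitaryGroup.localPi E c (n + n) JD v → ℂ} (hφ' : IsSphericalSection F E c hcδ hδ hd v n hT₀ hJD χv' s' φ')
    (h : UnitaryGroup.localPi E c (n + n) JD v) :
    localIntertwining F E c v n hJD νN φ h = localIntertwining F E c v n hJD νN φ 1 * φ' h := by
  obtain ⟨p, k, hp, hk, rfl⟩ := hIw h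
  rw [hM p hp k, localIntertwining_apply_of_mem_localInt F E c v n hJD νN hφK hk, hφ'.apply_siegel_mul_localInt hp hk]
  ring

/-- The same, as an identity of functions: `M_v φ = (M_v φ)(1) • φ'`. [cite: Casselman1980, §3] -/
theorem localIntertwining_eq_smul [MeasurableSpace (unipDeltaLocal F E c v n (JD := JD))]
    (νN : Measure (unipDeltaLocal F E c v n (JD := JD)))
    (hIw : ∀ h : UnitaryGroup.localPi E c (n + n) JD v, ∃ p k : UnitaryGroup.localPi E c (n + n) JD v,
      IsSiegelDelta F E c hcδ hδ hd v n hT₀ hJD p ∧ k ∈ UnitaryGroup.localInt E c (n + n) JD v ∧ h = p * k)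
    {φ : UnitaryGroup.localPi E c (n + n) JD v → ℂ}
    (hφK : ∀ k ∈ UnitaryGroup.localInt E c (n + n) JD v, ∀ h : UnitaryGroup.localPi E c (n + n) JD v, φ (h * k) = φ h)
    (χv' : ∀ w : PlacesOver E v, (w.1.adicCompletion E)ˣ →* ℂˣ) (s' : ℂ)
    (hM : IsLocalSiegelSection F E c hcδ hδ hd v n hT₀ hJD χv' s' (localIntertwining F E c v n hJD νN φ))
    {φ' : UnitaryGroup.localPi E c (n + n) JD v → ℂ} (hφ' : IsSphericalSection F E c hcδ hδ hd v n hT₀ hJD χv' s' φ') :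
    localIntertwining F E c v n hJD νN φ = localIntertwining F E c v n hJD νN φ 1 • φ' := by
  funext h
  rw [Pi.smul_apply, smul_eq_mul]
  exact localIntertwining_eq_apply_one_mul F E c hcδ hδ hd v n hT₀ hJD νN hIw hφK χv' s' hM hφ' h

/-- **For a spherical source**: `φ` spherical in `I_v(s, χ_v)` ⟹ `M_v φ (h) = M_v φ (1) · φ'(h)` under `hIw`, `hM`, `hφ'` (the form O41.5 consumes: `φ = φ°_s`,
`φ' = φ°_{−s}` of `I_v(−s, (χ_v ∘ c)⁻¹)`, `M_v φ°_s (1) = νN(N_Δ(𝒪_v)) · (a_v/b_v)(s)`). [cite: HarrisKudlaSweet1996, §6 (6.14)–(6.16)] -/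
theorem localIntertwining_eq_apply_one_mul_of_isSphericalSection [MeasurableSpace (unipDeltaLocal F E c v n (JD := JD))]
    (νN : Measure (unipDeltaLocal F E c v n (JD := JD)))
    (hIw : ∀ h : UnitaryGroup.localPi E c (n + n) JD v, ∃ p k : UnitaryGroup.localPi E c (n + n) JD v,
      IsSiegelDelta F E c hcδ hδ hd v n hT₀ hJD p ∧ k ∈ UnitaryGroup.localInt E c (n + n) JD v ∧ h = p * k)
    (χv : ∀ w : PlacesOver E v, (w.1.adicCompletion E)ˣ →* ℂˣ) (s : ℂ)
    {φ : UnitaryGroup.localPi E c (n + n) JD v → ℂ} (hφ : IsSphericalSection F E c hcδ hδ hd v n hT₀ hJD χv s φ)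
    (χv' : ∀ w : PlacesOver E v, (w.1.adicCompletion E)ˣ →* ℂˣ) (s' : ℂ)
    (hM : IsLocalSiegelSection F E c hcδ hδ hd v n hT₀ hJD χv' s' (localIntertwining F E c v n hJD νN φ))
    {φ' : UnitaryGroup.localPi E c (n + n) JD v → ℂ} (hφ' : IsSphericalSection F E c hcδ hδ hd v n hT₀ hJD χv' s' φ')
    (h : UnitaryGroup.localPi E c (n + n) JD v) :
    localIntertwining F E c v n hJD νN φ h = localIntertwining F E c v n hJD νN φ 1 * φ' h :=
  localIntertwining_eq_apply_one_mul F E c hcδ hδ hd v n hT₀ hJD νN hIw hφ.2.1 χv' s' hM hφ' h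

/-- If moreover `M_v φ (1) = 0` then `M_v φ` vanishes identically. [cite: Casselman1980, §3] -/
theorem localIntertwining_eq_zero_of_apply_one [MeasurableSpace (unipDeltaLocal F E c v n (JD := JD))]
    (νN : Measure (unipDeltaLocal F E c v n (JD := JD)))
    (hIw : ∀ h : UnitaryGroup.localPi E c (n + n) JD v, ∃ p k : UnitaryGroup.localPi E c (n + n) JD v,
      IsSiegelDelta F E c hcδ hδ hd v n hT₀ hJD p ∧ k ∈ UnitaryGroup.localInt E c (n + n) JD v ∧ h = p * k)
    {φ : UnitaryGroup.localPi E c (n + n) JD v → ℂ}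
    (hφK : ∀ k ∈ UnitaryGroup.localInt E c (n + n) JD v, ∀ h : UnitaryGroup.localPi E c (n + n) JD v, φ (h * k) = φ h)
    (χv' : ∀ w : PlacesOver E v, (w.1.adicCompletion E)ˣ →* ℂˣ) (s' : ℂ)
    (hM : IsLocalSiegelSection F E c hcδ hδ hd v n hT₀ hJD χv' s' (localIntertwining F E c v n hJD νN φ))
    (h0 : localIntertwining F E c v n hJD νN φ 1 = 0) (h : UnitaryGroup.localPi E c (n + n) JD v) :
    localIntertwining F E c v n hJD νN φ h = 0 := by
  obtain ⟨p, k, hp, hk, rfl⟩ := hIw h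
  rw [hM p hp k, localIntertwining_apply_of_mem_localInt F E c v n hJD νN hφK hk, h0, mul_zero]

end Summit.HodgeConjecture.HodgeConjecture.Cruxes.HLiu418.K2LiuLocalIntertwiningSphericalReduction

end
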